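import Summits.Ventures.PercRepro.RLSRuleTwoLinesSixDemand
import Summits.Ventures.PercRepro.RLSZeroWorldT1D
import Summits.Ventures.PercRepro.RLSPlanesT2_1
import Summits.Ventures.PercRepro.RLSPlanesT2_2
import Summits.Ventures.PercRepro.RLSPlanesT3_1
import Summits.Ventures.PercRepro.RLSSmallP
import Summits.Ventures.PercRepro.RLSRuleTwoLinesAny

/-!
# C-025 at q = 3: `R₃⁺` on the `6`-point planes with two `3`-point lines at EVERY type (night-3, gen 4)

`G` with `|G| = 6`, two `3`-point lines `ℓ, ℓ′` (`TwoLinesAny`), `c = |ℓ ∩ ℓ′| ∈ {0, 1}` — catalogue #12 (`c = 1`) and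
#14 (`c = 0`) — by the profile machine:

* `t = 1`: both lines charged, demand `≤ 39`, the certificates `W1.t1_two6P` (`c = 1`) / `W1.t1_two6D` (`c = 0`);
* `t = 2`: no loss, demand `≤ 33`, the landed `plane12_t2` / `plane14_t2` (+ `n = 4` from `RLSSmallP`);
* `t = 3`: no loss, the demanded triples have an independent complement: `≤ 16` (`c = 1`: the complements of the
  two lines are independent triples) / `≤ 18` (`c = 0`: each line's complement is the other line), the landed
  `plane12_t3` / `plane14_t3`; `t = 0`: `perFlat_twoLinesAny`; `t ≥ 4`: no demand.

**`perFlat_twoLinesSix_all`**: on `Core M (n + 4)`, `n ≥ 4`, every `6`-point plane with exactly two `3`-point lines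
satisfies the per-flat inequality of `R₃⁺`.  Imports `RLSRuleTwoLinesSixDemand`, `RLSZeroWorldT1D`, the landed tables
`RLSPlanesT2_1`, `RLSPlanesT2_2`, `RLSPlanesT3_1`, `RLSSmallP`, and `RLSRuleTwoLinesAny`.  Axioms: standard.
-/

open scoped Matroid

namespace PercRepro

namespace NightThree

open Finset ThmH PerFlat

variable {α : Type*} [DecidableEq α] {M : Matroid α} [M.Finite]

/-! ### The three types and the wrapper -/

/-- **`R₃⁺` at `t = 1` on a `6`-point plane with two lines**: both lines charged, demand `≤ 39`, the certificates
`W1.t1_two6P` / `W1.t1_two6D`. -/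
theorem perFlat_twoLinesSix_t1 {G ℓ ℓ' : Finset α} {n : ℕ} (hc : Core M (n + 4)) (hG : G ∈ flatsQ M 3)
    (h : TwoLinesAny M G ℓ ℓ') (hGc : G.card = 6) (hn : 4 ≤ n)
    (hK : M.eRk ((gr M \ G : Finset α) : Set α) = ((n + 3 : ℕ) : ℕ∞)) :
    phiK (n + 4) 3 * ((UqG M (n + 4) 3 G).card : ℚ) ≤ ∑ S ∈ Yq M (n + 4) 3, wPlus M G S := by
  classical
  obtain ⟨K, hKsub, hKind, hKcard⟩ := exists_indep_compl_card G (p := n + 3) (le_of_eq hK.symm)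
  have hmeet := card_inter_le_one_of_twoLines' hG h
  obtain ⟨C₀, hC₀K, hC₀c, hgood₀⟩ := exists_good_triple hG h.1 h.2.2.2.2.1 hKsub hKind (by rw [hKcard]; omega)
  obtain ⟨C₁, hC₁K, hC₁c, hgood₁⟩ := exists_good_triple hG h.2.1 h.2.2.2.2.2.1 hKsub hKind (by rw [hKcard]; omega)
  have hsup := twoLinesSix_supply hc hG h hGc hKsub hKind (n := n) (N := n) hKcard (by omega) hC₀K hC₀c hC₁K hC₁c
    hgood₀ hgood₁
  have e0 := sum_witness_eq_t1z0 hKcard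
  have e1 : ∑ X ∈ witnessFamily K n, 1 / (((4 + X.card).choose 3 : ℕ) : ℚ) = W1.t1z1Sum n := by
    rw [sum_witnessFamily K n (fun x => 1 / (((4 + x).choose 3 : ℕ) : ℚ)), hKcard]
    unfold W1.t1z1Sum; apply Finset.sum_congr rfl; intro i _; rw [show 4 + (i + 1) = i + 5 by omega]; ring
  have e2 : ∑ X ∈ witnessFamily K n, 1 / (((5 + X.card).choose 3 : ℕ) : ℚ) = W1.t1z2Sum n := by
    rw [sum_witnessFamily K n (fun x => 1 / (((5 + x).choose 3 : ℕ) : ℚ)), hKcard]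
    unfold W1.t1z2Sum; apply Finset.sum_congr rfl; intro i _; rw [show 5 + (i + 1) = i + 6 by omega]; ring
  have eW : ∑ _X ∈ witnessFamily K n, (1 : ℚ) = U1.w1Sum n := by
    rw [sum_witnessFamily K n (fun _ => (1 : ℚ)), hKcard]
    unfold U1.w1Sum; apply Finset.sum_congr rfl; intro i _; ring
  have l1 : ∑ j ∈ range (n - 2), (n.choose j : ℚ) * (1 / (((4 + (j + 3)).choose 3 : ℕ) : ℚ)) = W1.t1lost4Sum n := by
    unfold W1.t1lost4Sum; apply Finset.sum_congr rfl; intro j _; rw [show 4 + (j + 3) = j + 7 by omega]; ring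
  have l2 : ∑ j ∈ range (n - 2), (n.choose j : ℚ) * (1 / (((5 + (j + 3)).choose 3 : ℕ) : ℚ)) = W1.t1lost5Sum n := by
    unfold W1.t1lost5Sum; apply Finset.sum_congr rfl; intro j _; rw [show 5 + (j + 3) = j + 8 by omega]; ring
  have lW : ∑ j ∈ range (n - 2), (n.choose j : ℚ) * (1 : ℚ) = W1.t1lostSum n := by
    unfold W1.t1lostSum; apply Finset.sum_congr rfl; intro j _; ring
  rw [e0, e1, e2, eW, l1, l2, lW] at hsup
  have hdem : ((UqG M (n + 4) 3 G).card : ℚ) ≤ 39 := by exact_mod_cast card_UqG_le_twoLinesSix_t1 h hGc hK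
  have hphi : phiK (n + 4) 3 = ∑ i ∈ range n, ((n + 4).choose (i + 1) : ℚ) / ((i + 4).choose 3 : ℚ) := by
    unfold phiK; rw [phiW_eq_phiK_form n]; rfl
  have hstep : phiK (n + 4) 3 * ((UqG M (n + 4) 3 G).card : ℚ) ≤ 39 * phiK (n + 4) 3 := by
    have := mul_le_mul_of_nonneg_left hdem (phiK_nonneg (n + 4) 3); linarith
  rcases Nat.le_one_iff_eq_zero_or_eq_one.1 hmeet with hc0 | hc1
  · rw [hc0] at hsup; push_cast at hsup
    have hcert := W1.t1_two6D n hn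
    rw [← hphi] at hcert
    linarith
  · rw [hc1] at hsup; push_cast at hsup
    have hcert := W1.t1_two6P n hn
    rw [← hphi] at hcert
    linarith

/-- **`R₃⁺` at `t = 2` on a `6`-point plane with two lines**: no loss, demand `≤ 33`, the landed `plane12_t2`
(the same inequality for both shapes; `n = 4`: `SmallP.plane12_t2_n4`). -/
theorem perFlat_twoLinesSix_t2 {G ℓ ℓ' : Finset α} {n : ℕ} (hc : Core M (n + 4)) (hG : G ∈ flatsQ M 3)
    (h : TwoLinesAny M G ℓ ℓ') (hGc : G.card = 6) (hn : 4 ≤ n)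
    (hK : M.eRk ((gr M \ G : Finset α) : Set α) = ((n + 2 : ℕ) : ℕ∞)) :
    phiK (n + 4) 3 * ((UqG M (n + 4) 3 G).card : ℚ) ≤ ∑ S ∈ Yq M (n + 4) 3, wPlus M G S := by
  classical
  obtain ⟨K, hKsub, hKind, hKcard⟩ := exists_indep_compl_card G (p := n + 2) (le_of_eq hK.symm)
  have hlt : M.eRk ((gr M \ G : Finset α) : Set α) + 1 < M.eRank := by
    rw [hK, hc.2.1]
    calc ((n + 2 : ℕ) : ℕ∞) + 1 = ((n + 3 : ℕ) : ℕ∞) := by push_cast; ring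
      _ < ((n + 4 : ℕ) : ℕ∞) := by exact_mod_cast (by omega : n + 3 < n + 4)
  have hdep : depTriples M G = {ℓ, ℓ'} := depTriples_eq_pair_of_twoLinesAny h
  have hemp := coplanarTriples_eq_empty_of_two_le hc hG (by rw [hdep]; exact Finset.mem_insert_self _ _) hKsub hKind hlt
  have hemp' := coplanarTriples_eq_empty_of_two_le hc hG
    (by rw [hdep]; exact Finset.mem_insert_of_mem (Finset.mem_singleton_self _)) hKsub hKind hlt
  have hsup := twoLinesSix_supply_free hc hG h hGc hKsub hKind (n := n) hemp hemp'
  have e0 : ∑ X ∈ witnessFamily K n, 1 / (((3 + X.card).choose 3 : ℕ) : ℚ) = U2.r0Sum n := by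
    rw [sum_witnessFamily K n (fun x => 1 / (((3 + x).choose 3 : ℕ) : ℚ)), hKcard]
    unfold U2.r0Sum; apply Finset.sum_congr rfl; intro i _; rw [show 3 + (i + 1) = i + 4 by omega]; ring
  have e1 : ∑ X ∈ witnessFamily K n, 1 / (((4 + X.card).choose 3 : ℕ) : ℚ) = U2.r1Sum n := by
    rw [sum_witnessFamily K n (fun x => 1 / (((4 + x).choose 3 : ℕ) : ℚ)), hKcard]
    unfold U2.r1Sum; apply Finset.sum_congr rfl; intro i _; rw [show 4 + (i + 1) = i + 5 by omega]; ring
  have e2 : ∑ X ∈ witnessFamily K n, 1 / (((5 + X.card).choose 3 : ℕ) : ℚ) = U2.r2Sum n := by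
    rw [sum_witnessFamily K n (fun x => 1 / (((5 + x).choose 3 : ℕ) : ℚ)), hKcard]
    unfold U2.r2Sum; apply Finset.sum_congr rfl; intro i _; rw [show 5 + (i + 1) = i + 6 by omega]; ring
  have eW : ∑ _X ∈ witnessFamily K n, (1 : ℚ) = U2.w2Sum n := by
    rw [sum_witnessFamily K n (fun _ => (1 : ℚ)), hKcard]
    unfold U2.w2Sum; apply Finset.sum_congr rfl; intro i _; ring
  rw [e0, e1, e2, eW] at hsup
  have hdem : ((UqG M (n + 4) 3 G).card : ℚ) ≤ 33 := by exact_mod_cast card_UqG_le_twoLinesSix_t2 h hGc hK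
  have hphi : phiK (n + 4) 3 = ∑ i ∈ range n, ((n + 4).choose (i + 1) : ℚ) / ((i + 4).choose 3 : ℚ) := by
    unfold phiK; rw [phiW_eq_phiK_form n]; rfl
  have hcert : phiK (n + 4) 3 * 33 ≤ 18 * U2.r0Sum n + 54 * U2.r1Sum n + 54 * U2.r2Sum n + 1 * U2.w2Sum n := by
    rw [hphi]
    rcases (show n = 4 ∨ 5 ≤ n by omega) with h4 | h5
    · subst h4; exact SmallP.plane12_t2_n4
    · exact U2.Planes1.plane12_t2 n h5
  calc phiK (n + 4) 3 * ((UqG M (n + 4) 3 G).card : ℚ)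
      ≤ phiK (n + 4) 3 * 33 := mul_le_mul_of_nonneg_left hdem (phiK_nonneg _ _)
    _ ≤ ∑ S ∈ Yq M (n + 4) 3, wPlus M G S := by linarith

/-- **`R₃⁺` at `t = 3` on a `6`-point plane with two lines**: no loss; demand `≤ 16` (a common point,
`plane12_t3`) or `≤ 18` (disjoint lines, `plane14_t3`). -/
theorem perFlat_twoLinesSix_t3 {G ℓ ℓ' : Finset α} {n : ℕ} (hc : Core M (n + 4)) (hG : G ∈ flatsQ M 3)
    (h : TwoLinesAny M G ℓ ℓ') (hGc : G.card = 6) (hn : 4 ≤ n)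
    (hK : M.eRk ((gr M \ G : Finset α) : Set α) = ((n + 1 : ℕ) : ℕ∞)) :
    phiK (n + 4) 3 * ((UqG M (n + 4) 3 G).card : ℚ) ≤ ∑ S ∈ Yq M (n + 4) 3, wPlus M G S := by
  classical
  obtain ⟨K, hKsub, hKind, hKcard⟩ := exists_indep_compl_card G (p := n + 1) (le_of_eq hK.symm)
  have hmeet := card_inter_le_one_of_twoLines' hG h
  have hlt : M.eRk ((gr M \ G : Finset α) : Set α) + 1 < M.eRank := by
    rw [hK, hc.2.1]
    calc ((n + 1 : ℕ) : ℕ∞) + 1 = ((n + 2 : ℕ) : ℕ∞) := by push_cast; ring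
      _ < ((n + 4 : ℕ) : ℕ∞) := by exact_mod_cast (by omega : n + 2 < n + 4)
  have hdep : depTriples M G = {ℓ, ℓ'} := depTriples_eq_pair_of_twoLinesAny h
  have hemp := coplanarTriples_eq_empty_of_two_le hc hG (by rw [hdep]; exact Finset.mem_insert_self _ _) hKsub hKind hlt
  have hemp' := coplanarTriples_eq_empty_of_two_le hc hG
    (by rw [hdep]; exact Finset.mem_insert_of_mem (Finset.mem_singleton_self _)) hKsub hKind hlt
  have hsup := twoLinesSix_supply_free hc hG h hGc hKsub hKind (n := n) hemp hemp'
  have e0 : ∑ X ∈ witnessFamily K n, 1 / (((3 + X.card).choose 3 : ℕ) : ℚ) = U3.u0Sum n := by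
    rw [sum_witnessFamily K n (fun x => 1 / (((3 + x).choose 3 : ℕ) : ℚ)), hKcard]
    unfold U3.u0Sum; apply Finset.sum_congr rfl; intro i _; rw [show 3 + (i + 1) = i + 4 by omega]; ring
  have e1 : ∑ X ∈ witnessFamily K n, 1 / (((4 + X.card).choose 3 : ℕ) : ℚ) = U3.u1Sum n := by
    rw [sum_witnessFamily K n (fun x => 1 / (((4 + x).choose 3 : ℕ) : ℚ)), hKcard]
    unfold U3.u1Sum; apply Finset.sum_congr rfl; intro i _; rw [show 4 + (i + 1) = i + 5 by omega]; ring
  have e2 : ∑ X ∈ witnessFamily K n, 1 / (((5 + X.card).choose 3 : ℕ) : ℚ) = U3.u2Sum n := by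
    rw [sum_witnessFamily K n (fun x => 1 / (((5 + x).choose 3 : ℕ) : ℚ)), hKcard]
    unfold U3.u2Sum; apply Finset.sum_congr rfl; intro i _; rw [show 5 + (i + 1) = i + 6 by omega]; ring
  have eW : ∑ _X ∈ witnessFamily K n, (1 : ℚ) = U3.w3Sum n := by
    rw [sum_witnessFamily K n (fun _ => (1 : ℚ)), hKcard]
    unfold U3.w3Sum; apply Finset.sum_congr rfl; intro i _; ring
  rw [e0, e1, e2, eW] at hsup
  have hdem := card_UqG_le_twoLinesSix_t3 hG h hGc hK
  have hphi : phiK (n + 4) 3 = ∑ i ∈ range n, ((n + 4).choose (i + 1) : ℚ) / ((i + 4).choose 3 : ℚ) := by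
    unfold phiK; rw [phiW_eq_phiK_form n]; rfl
  rcases Nat.le_one_iff_eq_zero_or_eq_one.1 hmeet with hc0 | hc1
  · rw [hc0] at hdem
    have hdem' : ((UqG M (n + 4) 3 G).card : ℚ) ≤ 18 := by exact_mod_cast (by omega : (UqG M (n + 4) 3 G).card ≤ 18)
    have hcert := U3.Planes1.plane14_t3 n hn
    rw [← hphi] at hcert
    calc phiK (n + 4) 3 * ((UqG M (n + 4) 3 G).card : ℚ)
        ≤ phiK (n + 4) 3 * 18 := mul_le_mul_of_nonneg_left hdem' (phiK_nonneg _ _)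
      _ ≤ ∑ S ∈ Yq M (n + 4) 3, wPlus M G S := by linarith
  · rw [hc1] at hdem
    have hdem' : ((UqG M (n + 4) 3 G).card : ℚ) ≤ 16 := by exact_mod_cast (by omega : (UqG M (n + 4) 3 G).card ≤ 16)
    have hcert := U3.Planes1.plane12_t3 n hn
    rw [← hphi] at hcert
    calc phiK (n + 4) 3 * ((UqG M (n + 4) 3 G).card : ℚ)
        ≤ phiK (n + 4) 3 * 16 := mul_le_mul_of_nonneg_left hdem' (phiK_nonneg _ _)
      _ ≤ ∑ S ∈ Yq M (n + 4) 3, wPlus M G S := by linarith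

open scoped Classical in
/-- **`R₃⁺` on every `6`-point plane with exactly two `3`-point lines at EVERY type**, every `p = n + 4 ≥ 8`, on a
core matroid. -/
theorem perFlat_twoLinesSix_all {G ℓ ℓ' : Finset α} {n : ℕ} (hc : Core M (n + 4)) (hG : G ∈ flatsQ M 3)
    (h : TwoLinesAny M G ℓ ℓ') (hGc : G.card = 6) (hn : 4 ≤ n) :
    phiK (n + 4) 3 * ((UqG M (n + 4) 3 G).card : ℚ) ≤ ∑ S ∈ Yq M (n + 4) 3, wPlus M G S := by
  obtain ⟨e, he, _⟩ := eRk_eq_nat M (gr M \ G)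
  rcases le_or_gt (n + 4) e with h0 | h0
  · exact perFlat_twoLinesAny hG h hn (by rw [he]; exact_mod_cast h0)
  rcases Nat.lt_or_ge e (n + 1) with h4 | h1
  · have hdem := card_UqG_le_of_eRk_compl G (p := n + 4) (t := 4) he (by omega)
    have h0' : demandCount G.card 4 = 0 := by
      rw [hGc]; unfold demandCount; norm_num [Finset.sum_range_succ]
    rw [h0'] at hdem
    have hU : ((UqG M (n + 4) 3 G).card : ℚ) = 0 := le_antisymm hdem (by positivity)
    rw [hU, mul_zero]
    exact Finset.sum_nonneg (fun S _ => wPlus_nonneg M G S)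
  rcases (show e = n + 1 ∨ e = n + 2 ∨ e = n + 3 by omega) with h1' | h2' | h3'
  · exact perFlat_twoLinesSix_t3 hc hG h hGc hn (by rw [he, h1'])
  · exact perFlat_twoLinesSix_t2 hc hG h hGc hn (by rw [he, h2'])
  · exact perFlat_twoLinesSix_t1 hc hG h hGc hn (by rw [he, h3'])

end NightThree

end PercRepro
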